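import Summits.ResolutionOfSingularities.ResolutionOfSingularities.Theorems.SplitTowerPoint

/-!
# Split-cone tower — slice St: the engine (one curve blow-up per stage, strong induction on the weight)

Node «SplitTower» of `decomp-res-lens-2` (g34), see `Theorems/MaxContactCutSplitTower.lean`.

`splitStage` — the stage data are a regular locally Noetherian `Z`, a marked ideal `(𝓘, n)` (`n ≥ 2`), a target
set `T`, and a TRACKED curve point `ζ` (a non-closed point with a proper specialisation, all of whose specialisations
lie in `T`) such that (I1) at every proper specialisation `x` of `ζ` the stalk `𝓘_x` carries a split shape of weight
`k ≥ n` along the curve prime `𝔓_{ζ,x}` (slice `SplitTowerShape`), and (I4) at every point of `T` of order `n` OFF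
the curve `cl{ζ}` Hironaka's `τ ≥ 2`.  The stage blows up the regular curve `C = 𝓘(cl{ζ})` (inside `supp(𝓘, n) ∩ T`);
if `k - n < n` it stops — after the blow-up every order-`n` point over `T` has `τ ≥ 2` (`exit_generic`, `exit_closed`,
off-curve transport) — and otherwise the invariant holds on the blow-up with the new curve point `ζ₁ = q₂ 𝔴̃₀`
(independent of the closed point used to construct it, `eq_originPt`) and weight `k - n`
(`shape_of_originPt_specializes`, `tau_of_not_specializes`), and the engine recurses.  The blow-ups form a weakly
admissible sequence with centres over `T`. [cite: CossartJannsenSaito2020, Ch. 2] [cite: Hironaka1964]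
-/

noncomputable section

open CategoryTheory AlgebraicGeometry TopologicalSpace Topology IsLocalRing
open Literature.AlgebraicGeometry.Resolution
open Summit.ResolutionOfSingularities.ResolutionOfSingularities.Theorems
open Summit.ResolutionOfSingularities.ResolutionOfSingularities.Theorems.WeakOrderReduction
open Summit.ResolutionOfSingularities.ResolutionOfSingularities.Theorems.RelativeDeltaCut
open Summit.ResolutionOfSingularities.ResolutionOfSingularities.Theorems.SplitCut

namespace Summit.ResolutionOfSingularities.ResolutionOfSingularities.Theorems.SplitTower

section Stage

/-- **THE SPLIT-CONE TOWER ENGINE** (see the module docstring): from the stage invariant with weight `k` at the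
tracked curve point `ζ`, a weakly admissible sequence of curve blow-ups with centres over `T`, regular top, and
Hironaka's `τ ≥ 2` at every order-`n` point over `T` of the final transform. [cite: CossartJannsenSaito2020, Ch. 2] -/
theorem splitStage (k : ℕ) : ∀ {Z : Scheme.{0}} [IsLocallyNoetherian Z] (hZ : Scheme.IsRegular Z)
    (M : MarkedIdeal Z) (T : Set Z) (ζ : Z), 2 ≤ M.mult → M.mult ≤ k →
    (∀ x, ζ ⤳ x → x ∈ T) → (∃ x, ζ ⤳ x ∧ x ≠ ζ) →
    (∀ (x : Z) (h : ζ ⤳ x), x ≠ ζ → Nonempty (SplitShape (stalkIdeal M.ideal x) (curvePrime h) M.mult k)) →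
    (∀ x ∈ T, ¬ ζ ⤳ x → (M.mult : ℕ∞) ≤ idealOrder M.ideal x → 2 ≤ tauAt hZ M.ideal M.mult x) →
    ∃ s : CentreSeq Z, WeakAdmissible s M ∧ s.CentresOver T ∧ ∃ hT : Scheme.IsRegular s.top,
      ∀ x : ↑s.top, s.comp x ∈ T → (M.mult : ℕ∞) ≤ idealOrder (s.transformMarked M).ideal x →
        2 ≤ tauAt hT (s.transformMarked M).ideal M.mult x := by
  induction k using Nat.strong_induction_on with
  | _ k ih =>
  intro Z _ hZ M T ζ hn hnk hTζ hne hI1 hI4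
  obtain ⟨x₀, hx₀, hx₀ne⟩ := hne
  -- §1 the curve centre `C = 𝓘(cl{ζ})`: support, stalks, regularity, inside `supp(𝓘, n) ∩ T`
  set C : Z.IdealSheafData :=
    Scheme.IdealSheafData.vanishingIdeal (⟨closure ({ζ} : Set Z), isClosed_closure⟩ : Closeds Z) with hCdef
  have hCsupp : ∀ y : Z, y ∈ (C.support : Set Z) ↔ ζ ⤳ y := fun y => by
    rw [hCdef, coe_support_vanishingIdeal, specializes_iff_mem_closure]
    rfl
  have hCst : ∀ (y : Z) (h : ζ ⤳ y), stalkIdeal C y = curvePrime h := fun y h => by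
    rw [hCdef, stalkIdeal_vanishingIdeal_closure h]
    rfl
  have hCreg : Scheme.IsRegular C.subscheme := by
    refine isRegular_subscheme_vanishingIdeal_closure_of_forall fun z hz => ?_
    by_cases hzζ : z = ζ
    · subst hzζ
      exact isRegularLocalRing_stalk_quotient_primeOfSpecializes_self z
    · obtain ⟨D⟩ := hI1 z hz hzζ
      change IsRegularLocalRing (Z.presheaf.stalk z ⧸ curvePrime hz)
      exact D.isRegularLocalRing_quot
  have hsuppT : (C.support : Set Z) ⊆ T := fun y hy => hTζ y ((hCsupp y).mp hy)
  have hsuppM : (C.support : Set Z) ⊆ M.support := by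
    intro y hy
    have h : ζ ⤳ y := (hCsupp y).mp hy
    rw [MarkedIdeal.mem_support_iff]
    by_cases hyζ : y = ζ
    · subst hyζ
      obtain ⟨D⟩ := hI1 x₀ hx₀ hx₀ne
      exact stalkIdeal_le_pow_of_le_primeOfSpecializes_pow hx₀ M.ideal (D.le_pow hnk)
    · obtain ⟨D⟩ := hI1 y h hyζ
      exact D.le_maximalIdeal_pow hnk
  -- §2 the blow-up `Z₁ → Z` of `C` is regular; shapes and chart families at the points of the curve
  haveI := CentreSeq.isLocallyNoetherian_blowup C
  have hZ' : Scheme.IsRegular ↑(blowup C) :=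
    IsBlowup.isRegular_of_isRegular_subscheme hZ hCreg (blowup.isBlowup C)
  have hF : ∀ (y : Z) (h : ζ ⤳ y), y ≠ ζ →
      ∃ D : SplitShape (stalkIdeal M.ideal y) (curvePrime h) M.mult k,
        Ideal.span (Set.range D.c) = stalkIdeal C y ∧ Nonempty (ChartFamily (blowup.π C) y D.c) := by
    intro y h hne
    obtain ⟨D⟩ := hI1 y h hne
    have hc : Ideal.span (Set.range D.c) = stalkIdeal C y := by rw [D.span_c, hCst y h]
    exact ⟨D, hc, ChartFamily.nonempty (blowup.isBlowup C) y D.c hc⟩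
  obtain ⟨D₀, hc₀, ⟨F₀⟩⟩ := hF x₀ hx₀ hx₀ne
  -- off the curve the blow-up is a local isomorphism: (I4) is transported
  have hoff : ∀ x' : ↑(blowup C), ¬ ζ ⤳ blowup.π C x' → blowup.π C x' ∈ T →
      (M.mult : ℕ∞) ≤ idealOrder (controlledTransform (blowup.π C) C M.ideal M.mult) x' →
      2 ≤ tauAt hZ' (controlledTransform (blowup.π C) C M.ideal M.mult) M.mult x' := by
    intro x' hns hT hord
    have hx : blowup.π C x' ∉ (C.support : Set Z) := fun h => hns ((hCsupp _).mp h)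
    rw [(blowup.isBlowup C).idealOrder_controlledTransform_of_not_mem M.ideal M.mult hx] at hord
    have hτ := hI4 _ hT hns hord
    haveI := hZ (blowup.π C x')
    haveI := hZ' x'
    change 2 ≤ stalkTau (controlledTransform (blowup.π C) C M.ideal M.mult) x' M.mult
    rw [(blowup.isBlowup C).stalkTau_controlledTransform_of_not_mem M.ideal M.mult M.mult hx]
    exact hτ
  by_cases hk : k - M.mult < M.mult
  · -- §3a EXIT: blow up `C` once and stop
    refine ⟨CentreSeq.cons C (CentreSeq.nil _), ⟨hsuppM, hCreg, trivial⟩, ⟨hsuppT, trivial⟩, hZ',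
      fun x' hx' hord => ?_⟩
    have hxT : blowup.π C x' ∈ T := hx'
    simp only [CentreSeq.transformMarked_cons, CentreSeq.transformMarked_nil] at hord ⊢
    change (M.mult : ℕ∞) ≤ idealOrder (controlledTransform (blowup.π C) C M.ideal M.mult) x' at hord
    change 2 ≤ tauAt hZ' (controlledTransform (blowup.π C) C M.ideal M.mult) M.mult x'
    by_cases hζx : ζ ⤳ blowup.π C x'
    · have hord' := (le_idealOrder_iff _ x' M.mult).mp hord
      by_cases hπ : blowup.π C x' = ζ
      · exact absurd hord' (exit_generic D₀ hc₀ F₀ hZ' hk hn hnk x' hπ)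
      · obtain ⟨D, hc, ⟨F⟩⟩ := hF _ hζx hπ
        exact exit_closed D hc F hZ' hk hn hnk x' rfl hord'
    · exact hoff x' hζx hxT hord
  · -- §3b STEP: blow up `C`, track the new curve point `ζ₁ = q₂ 𝔴̃₀`, recurse with weight `k - n`
    push Not at hk
    have hζ' : ∀ x' : ↑(blowup C), blowup.π C x' = ζ →
        stalkIdeal (controlledTransform (blowup.π C) C M.ideal M.mult) x' ≤ maximalIdeal _ ^ M.mult →
        x' = F₀.q 2 (originPt D₀) := fun x' hx' hle => eq_originPt D₀ hc₀ F₀ hn hnk x' hx' hle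
    obtain ⟨rest, hwa, hco, hT, hexit⟩ := ih (k - M.mult) (by omega) hZ'
      (M.transform (blowup.π C) C) (blowup.π C ⁻¹' T) (F₀.q 2 (originPt D₀)) hn hk
      (fun x' h => hTζ _ (specializes_base_of_originPt_specializes D₀ F₀ h))
      (exists_special_originPt D₀ F₀ hx₀ne)
      (fun x' h hne => by
        change Nonempty (SplitShape (stalkIdeal (controlledTransform (blowup.π C) C M.ideal M.mult) x')
          (curvePrime h) M.mult (k - M.mult))
        have hζx : ζ ⤳ blowup.π C x' := specializes_base_of_originPt_specializes D₀ F₀ h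
        by_cases hπ : blowup.π C x' = ζ
        · exact absurd (eq_of_originPt_specializes D₀ hc₀ F₀ hZ' hn hnk hk x' hπ h) hne
        · obtain ⟨D, hc, ⟨F⟩⟩ := hF _ hζx hπ
          exact shape_of_originPt_specializes D hc F hn hnk hk (F₀.q 2 (originPt D₀))
            (hζ' _ (F.base_originPt D) (le_pow_originPt D hc F hnk hk)).symm x' rfl h)
      (fun x' hx' hns hord => by
        have hxT : blowup.π C x' ∈ T := hx'
        change (M.mult : ℕ∞) ≤ idealOrder (controlledTransform (blowup.π C) C M.ideal M.mult) x' at hord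
        change 2 ≤ tauAt hZ' (controlledTransform (blowup.π C) C M.ideal M.mult) M.mult x'
        by_cases hζx : ζ ⤳ blowup.π C x'
        · have hord' := (le_idealOrder_iff _ x' M.mult).mp hord
          by_cases hπ : blowup.π C x' = ζ
          · exact absurd (specializes_of_eq (hζ' x' hπ hord').symm) hns
          · obtain ⟨D, hc, ⟨F⟩⟩ := hF _ hζx hπ
            refine tau_of_not_specializes D hc F hZ' hn hnk x' rfl hord' fun h => hns ?_
            exact (specializes_of_eq (hζ' _ (F.base_originPt D) (le_pow_originPt D hc F hnk hk)).symm).trans h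
        · exact hoff x' hζx hxT hord)
    refine ⟨CentreSeq.cons C rest, ⟨hsuppM, hCreg, hwa⟩, ⟨hsuppT, hco⟩, hT, fun x hx hord => ?_⟩
    have hx' : rest.comp x ∈ blowup.π C ⁻¹' T := hx
    simpa [CentreSeq.transformMarked_cons] using
      hexit x hx' (by simpa [CentreSeq.transformMarked_cons] using hord)

end Stage

end Summit.ResolutionOfSingularities.ResolutionOfSingularities.Theorems.SplitTower

end
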